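import Summits.QuantumFields.YangMills.Theorems.LuscherReductionTwistedTraceScalingBTTails
import Summits.QuantumFields.YangMills.Theorems.LuscherReductionTwistedTraceScalingBTWindow
import HarnessLib

/-!
# TAIL DEFECTS from the ACTUAL maximal gauge jump: off the core (near pairs) and everywhere (far pairs) the kinetic defect is bounded below by explicit window/core quantities
# (lane A of S-BASE, crux `TwistedTraceScaling` stmt-QuantumFields-20203, C4-CORE, the (B-T) pen; design note `pub/ym-fleet/ym-luscher-20007-p1/COARSE-DESIGN.md` §25.9 + seat NOTES (max-jump refinement))

Let `R_m` be the maximal jump `‖q(g_y) − q(g_x)‖` over edges (`exists_max_jump`).  Pinning bounds the amplitude by `9L·R_m + ε` (when `3LR_m < 1`), so the rough-edge bound AT THE MAXIMAL EDGE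
has junk proportional to `R_m` itself — no intermediate cutoff is needed:
* `norm_su2Quat_sub_one_le_two` (`‖q(g) − 1‖ ≤ 2`);
* ★★ `kinDefect_ge_off_core` — NEAR pair (`‖q(U_e) − 1‖ ≤ a`, `‖q(U_e) − q(V_e)‖ ≤ b` on the supports), `colourMean g ∈ fpBall ε`, some jump `≥ R₁`, `18La ≤ 1/2`:
  `kinDefect ≥ (min (R₁/2 − 2aε − b) (1/(3L) − 4a − b))²`;
* ★★ `kinDefect_ge_far` — FAR pair (`‖q(u_k) − q(u'_k)‖ ≥ α` for some `k`), every pinned `g`: either the rough bound `(P₀ − 4a − b)²` (some jump `≥ P₀`) or the far-pair bound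
  `(N(1 − 3LP₀)α − J)²/|E|` (all jumps `≤ P₀`, `…BTTails.sq_le_card_mul_kinDefect_of_far` with the fibre norms replaced by their bound `R`).
HONEST FRAMING: bookkeeping for a stub of a child of the CONDITIONAL reduction route R2b1; rates and assembly OPEN; C4-CORE OPEN; not infinite volume, not a gap, not Clay.
-/

set_option autoImplicit false

noncomputable section

open MeasureTheory Filter Topology Real
open scoped BigOperators Matrix Quaternion
open Literature.MathematicalPhysics.QuantumFieldTheory
open Literature.MathematicalPhysics.QuantumLattice

namespace Summit.QuantumFields.YangMills.Theorems.FemtoTransferGap.TwoLattice.ConstTube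

open Summit.QuantumFields.YangMills.Theorems.FemtoTransferGap
open Summit.QuantumFields.YangMills.Theorems.FemtoTransferGap.TwoLattice
open Summit.QuantumFields.YangMills.Theorems.FemtoTransferGap.TwoLattice.Avg
open Summit.QuantumFields.YangMills.Theorems.FemtoTransferGap.TwoLattice.Stiff (LinkSpace)

variable {L : ℕ} [NeZero L]

/-! ## §1 The maximal jump and the trivial amplitude bound -/

/-- There is an edge with maximal gauge jump. [folklore] -/
theorem exists_max_jump (g : Site 3 L → SU2) :
    ∃ e₀ : Edge 3 L, ∀ e : Edge 3 L, ‖su2Quat (g (e.1.shift e.2)) - su2Quat (g e.1)‖ ≤ ‖su2Quat (g (e₀.1.shift e₀.2)) - su2Quat (g e₀.1)‖ := by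
  obtain ⟨e₀, -, h⟩ := Finset.exists_max_image Finset.univ (fun e : Edge 3 L => ‖su2Quat (g (e.1.shift e.2)) - su2Quat (g e.1)‖) Finset.univ_nonempty
  exact ⟨e₀, fun e => h e (Finset.mem_univ e)⟩

omit [NeZero L] in
/-- `‖q(g) − 1‖ ≤ 2`. [folklore] -/
theorem norm_su2Quat_sub_one_le_two (g : SU2) : ‖su2Quat g - 1‖ ≤ 2 := by
  refine (norm_sub_le _ _).trans ?_; rw [norm_su2Quat, norm_one]; norm_num

/-! ## §2 ★★ Off the core (near pairs) -/

/-- ★★ **Off-core defect**: with `‖q(U_e) − 1‖ ≤ a` and `‖q(U_e) − q(V_e)‖ ≤ b` on all edges, `colourMean g ∈ fpBall ε`, `18La ≤ 1/2`, and SOME jump `≥ R₁`: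
`kinDefect U V g ≥ (min (R₁/2 − 2aε − b) (1/(3L) − 4a − b))²` (both entries assumed `≥ 0`). [cite: Luscher1983, §3] -/
theorem kinDefect_ge_off_core (U V : GaugeConfig 3 L SU2) (g : Site 3 L → SU2) {a b ε R₁ : ℝ} (ha : ∀ e : Edge 3 L, ‖su2Quat (U e) - 1‖ ≤ a)
    (hb : ∀ e : Edge 3 L, ‖su2Quat (U e) - su2Quat (V e)‖ ≤ b) (hW : colourMean L g ∈ fpBall ε) (hLa : 18 * L * a ≤ 1 / 2)
    (hR₁ : ∃ e : Edge 3 L, R₁ ≤ ‖su2Quat (g (e.1.shift e.2)) - su2Quat (g e.1)‖) (hm₁ : 0 ≤ R₁ / 2 - 2 * a * ε - b) (hm₂ : 0 ≤ 1 / (3 * L) - 4 * a - b) :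
    (min (R₁ / 2 - 2 * a * ε - b) (1 / (3 * L) - 4 * a - b)) ^ 2 ≤ kinDefect L U V g := by
  obtain ⟨e₀, he₀⟩ := exists_max_jump (L := L) g
  obtain ⟨e₁, he₁⟩ := hR₁
  set Rm := ‖su2Quat (g (e₀.1.shift e₀.2)) - su2Quat (g e₀.1)‖ with hRm
  have hRm1 : R₁ ≤ Rm := he₁.trans (he₀ e₁)
  have ha0 : 0 ≤ a := (norm_nonneg _).trans (ha default)
  have hL : (1 : ℝ) ≤ L := by exact_mod_cast NeZero.one_le
  have hmin0 : 0 ≤ min (R₁ / 2 - 2 * a * ε - b) (1 / (3 * L) - 4 * a - b) := le_min hm₁ hm₂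
  by_cases h3 : 3 * L * Rm < 1
  · -- pinned amplitude `≤ 9L·Rm + ε`
    have hA := norm_su2Quat_sub_one_le_of_jumps (L := L) he₀ h3 hW
    have hpos : 0 ≤ Rm - 2 * a * (9 * L * Rm + ε) - b := by nlinarith [norm_nonneg (su2Quat (g (e₀.1.shift e₀.2)) - su2Quat (g e₀.1))]
    have h := kinDefect_ge_of_jump U V g e₀ le_rfl (ha e₀) (hb e₀) (hA e₀.1) hpos
    refine le_trans (pow_le_pow_left₀ hmin0 ((min_le_left _ _).trans ?_) 2) h
    nlinarith [norm_nonneg (su2Quat (g (e₀.1.shift e₀.2)) - su2Quat (g e₀.1))]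
  · push Not at h3
    have hRm3 : 1 / (3 * L) ≤ Rm := by rw [div_le_iff₀ (by positivity)]; linarith
    have hpos : 0 ≤ Rm - 2 * a * 2 - b := by linarith
    have h := kinDefect_ge_of_jump U V g e₀ le_rfl (ha e₀) (hb e₀) (norm_su2Quat_sub_one_le_two _) hpos
    refine le_trans (pow_le_pow_left₀ hmin0 ((min_le_right _ _).trans ?_) 2) h
    linarith

/-! ## §3 ★★ Far pairs -/

/-- ★★ **Far-pair defect** on the tube: `‖q(u_k) − q(u'_k)‖ ≥ α` for some `k`, pinned `g`, balanced capped fibres with `‖v̂‖, ‖v̂'‖ ≤ R`, tube-link bounds `a, b`, a rough threshold `P₀`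
with `3LP₀ < 1`: `kinDefect ≥ min ((P₀ − 4a − b)²) ((N(1−3LP₀)α − J)²/|E|)`, `J = 2εNδ + 2R² + 2√2N(9LP₀ + ε)R` (`‖q(u_k) − 1‖ ≤ δ`). [cite: Luscher1983, §3] -/
theorem kinDefect_ge_far (u u' : GaugeConfig 3 1 SU2) {v v' : Edge 3 L → Fin 3 → ℝ} (hv : v ∈ capBalancedSet L) (hv' : v' ∈ capBalancedSet L) (g : Site 3 L → SU2)
    {a b ε δ α R P₀ : ℝ} (ha : ∀ e : Edge 3 L, ‖su2Quat (orthoTube L u v e) - 1‖ ≤ a) (hb : ∀ e : Edge 3 L, ‖su2Quat (orthoTube L u v e) - su2Quat (orthoTube L u' v' e)‖ ≤ b)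
    (hε : 0 ≤ ε) (hW : colourMean L g ∈ fpBall ε) (hδ : ∀ k : Fin 3, ‖su2Quat (u (0, k)) - 1‖ ≤ δ) (hfar : ∃ k : Fin 3, α ≤ ‖su2Quat (u (0, k)) - su2Quat (u' (0, k))‖)
    (hvR : ‖linkEmbed L v‖ ≤ R) (hv'R : ‖linkEmbed L v'‖ ≤ R) (hP : 3 * L * P₀ < 1) (hP0 : 0 ≤ P₀ - 4 * a - b)
    (hJ : 2 * ε * Fintype.card (Site 3 L) * δ + 2 * R ^ 2 + 2 * Real.sqrt 2 * Fintype.card (Site 3 L) * (9 * L * P₀ + ε) * R ≤ Fintype.card (Site 3 L) * (1 - 3 * L * P₀) * α) :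
    min ((P₀ - 4 * a - b) ^ 2)
        ((Fintype.card (Site 3 L) * (1 - 3 * L * P₀) * α - (2 * ε * Fintype.card (Site 3 L) * δ + 2 * R ^ 2 + 2 * Real.sqrt 2 * Fintype.card (Site 3 L) * (9 * L * P₀ + ε) * R)) ^ 2 /
          Fintype.card (Edge 3 L)) ≤ kinDefect L (orthoTube L u v) (orthoTube L u' v') g := by
  obtain ⟨e₀, he₀⟩ := exists_max_jump (L := L) g
  obtain ⟨k, hk⟩ := hfar
  set Rm := ‖su2Quat (g (e₀.1.shift e₀.2)) - su2Quat (g e₀.1)‖ with hRm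
  have hN : (0 : ℝ) < Fintype.card (Site 3 L) := by exact_mod_cast Fintype.card_pos
  have hE : (0 : ℝ) < Fintype.card (Edge 3 L) := by exact_mod_cast Fintype.card_pos
  have hR0 : 0 ≤ R := (norm_nonneg _).trans hvR
  have hδ0 : 0 ≤ δ := (norm_nonneg _).trans (hδ 0)
  have hP00 : 0 ≤ P₀ := by have := (norm_nonneg _).trans (ha default); have := (norm_nonneg _).trans (hb default); linarith
  by_cases hrough : P₀ ≤ Rm
  · -- rough: the maximal edge alone
    have hpos : 0 ≤ Rm - 2 * a * 2 - b := by linarith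
    have h := kinDefect_ge_of_jump (orthoTube L u v) (orthoTube L u' v') g e₀ le_rfl (ha e₀) (hb e₀) (norm_su2Quat_sub_one_le_two _) hpos
    refine (min_le_left _ _).trans (le_trans (pow_le_pow_left₀ hP0 (by linarith) 2) h)
  · push Not at hrough
    have hjumps : ∀ e : Edge 3 L, ‖su2Quat (g (e.1.shift e.2)) - su2Quat (g e.1)‖ ≤ P₀ := fun e => (he₀ e).trans hrough.le
    -- the actual junk is below the `R`-junk
    have hJle : 2 * ε * Fintype.card (Site 3 L) * ‖su2Quat (u (0, k)) - 1‖ + ‖linkEmbed L v‖ ^ 2 + ‖linkEmbed L v'‖ ^ 2 +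
        Real.sqrt 2 * Fintype.card (Site 3 L) * (9 * L * P₀ + ε) * (‖linkEmbed L v‖ + ‖linkEmbed L v'‖) ≤
        2 * ε * Fintype.card (Site 3 L) * δ + 2 * R ^ 2 + 2 * Real.sqrt 2 * Fintype.card (Site 3 L) * (9 * L * P₀ + ε) * R := by
      have h1 := mul_le_mul_of_nonneg_left (hδ k) (by positivity : (0 : ℝ) ≤ 2 * ε * Fintype.card (Site 3 L))
      have h2 := pow_le_pow_left₀ (norm_nonneg _) hvR 2
      have h3 := pow_le_pow_left₀ (norm_nonneg _) hv'R 2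
      have h4 := mul_le_mul_of_nonneg_left (add_le_add hvR hv'R) (by positivity : (0 : ℝ) ≤ Real.sqrt 2 * Fintype.card (Site 3 L) * (9 * L * P₀ + ε))
      linarith
    have hJ' : 2 * ε * Fintype.card (Site 3 L) * ‖su2Quat (u (0, k)) - 1‖ + ‖linkEmbed L v‖ ^ 2 + ‖linkEmbed L v'‖ ^ 2 +
        Real.sqrt 2 * Fintype.card (Site 3 L) * (9 * L * P₀ + ε) * (‖linkEmbed L v‖ + ‖linkEmbed L v'‖) ≤ Fintype.card (Site 3 L) * (1 - 3 * L * P₀) * α := hJle.trans hJ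
    have h := sq_le_card_mul_kinDefect_of_far u u' hv hv' hjumps hP hε hW k hk hJ'
    refine (min_le_right _ _).trans ?_
    rw [div_le_iff₀ hE]
    have hmono : (Fintype.card (Site 3 L) * (1 - 3 * L * P₀) * α - (2 * ε * Fintype.card (Site 3 L) * δ + 2 * R ^ 2 + 2 * Real.sqrt 2 * Fintype.card (Site 3 L) * (9 * L * P₀ + ε) * R)) ^ 2 ≤
        (Fintype.card (Site 3 L) * (1 - 3 * L * P₀) * α - (2 * ε * Fintype.card (Site 3 L) * ‖su2Quat (u (0, k)) - 1‖ + ‖linkEmbed L v‖ ^ 2 + ‖linkEmbed L v'‖ ^ 2 +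
          Real.sqrt 2 * Fintype.card (Site 3 L) * (9 * L * P₀ + ε) * (‖linkEmbed L v‖ + ‖linkEmbed L v'‖))) ^ 2 :=
      pow_le_pow_left₀ (by linarith) (by linarith) 2
    calc _ ≤ (Fintype.card (Site 3 L) * (1 - 3 * L * P₀) * α - (2 * ε * Fintype.card (Site 3 L) * ‖su2Quat (u (0, k)) - 1‖ + ‖linkEmbed L v‖ ^ 2 + ‖linkEmbed L v'‖ ^ 2 +
          Real.sqrt 2 * Fintype.card (Site 3 L) * (9 * L * P₀ + ε) * (‖linkEmbed L v‖ + ‖linkEmbed L v'‖))) ^ 2 := hmono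
      _ ≤ (Fintype.card (Edge 3 L) : ℝ) * kinDefect L (orthoTube L u v) (orthoTube L u' v') g := h
      _ = kinDefect L (orthoTube L u v) (orthoTube L u' v') g * Fintype.card (Edge 3 L) := mul_comm _ _

end Summit.QuantumFields.YangMills.Theorems.FemtoTransferGap.TwoLattice.ConstTube

end
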